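import Mathlib
import Summits.KontsevichZagierPeriods.KontsevichZagierPeriods.Theses.LiftingCriteria

/-!
# Negative lemma for item `stmt-KontsevichZagierPeriods-3626` (`ESectorBeukers`, route LiftingCriteria)

Small-model fact supporting the (informal, undecl'd) E-sector rung: the NAIVE reading of its part (d)
— "every ℚ̄-linear relation among the values at ϖ = 1 is the specialisation of a ℚ̄[ϖ]-linear
relation among THE GIVEN functions" — is false (`naiveLiftAtOne_false`), while the MODULE reading
(lift inside the ∂-stable ℚ[ϖ]-module of all `∫_P e^{-ϖf} h`, "the given functions and their
derivatives" in the item's words) holds on the same witness with an explicit certificate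
(`moduleLift_witness`). No Theses decl is asserted or denied (the item has none); this file is
negative knowledge for whoever types the rung: type (d) in module form only.

Witness: `e(ϖ) = ∫₀¹ e^{-ϖt}(1 - 3t + t²) dt`, `e(1) = 0`, `e(0) = -1/6`; the functional relation
`I₀ - (2+ϖ) I₁ + ϖ I₂ ≡ 0` among `I_k(ϖ) = ∫₀¹ t^k e^{-ϖt} dt` specialises at `ϖ = 1` to `(1,-3,1)`.
[cite: Beukers2006, arXiv:math/0405549 p. 2 Thm 3 / Cor 4, p. 3 Cor 7 — the `(z-1)e^z` phenomenon]
-/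

noncomputable section

open MeasureTheory Set MvPolynomial

namespace Summit.KontsevichZagierPeriods.KontsevichZagierPeriods.Theorems.ESectorBeukers.Negative

/-- The closed unit cube `[0,1]^n ⊂ ℝ^n`, written exactly as in the route file. -/
def cube (n : ℕ) : Set (Fin n → ℝ) := Set.pi Set.univ (fun _ : Fin n => Set.Icc (0:ℝ) 1)

/-- The exponential dilation function of the E-sector in cube form:
`E f h ϖ = ∫_{[0,1]^n} e^{-ϖ f(z)} h(z) dz` for `f h ∈ ℚ[z₀,…,z_{n-1}]`. -/
def E {n : ℕ} (f h : MvPolynomial (Fin n) ℚ) (ϖ : ℝ) : ℝ :=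
  ∫ z in cube n, Real.exp (-(ϖ * aeval z f)) * aeval z h

/-- NAIVE reading of part (d) of `ESectorBeukers` (lift among the GIVEN functions only), in its
weakest form: real polynomial coefficients, functional relation only on `[0,1]`.
Refuted below (`naiveLiftAtOne_false`). Do NOT type the item in this form. A refuted reading, not a named fact.
[topic: Summits/KontsevichZagierPeriods/KontsevichZagierPeriods — E-sector lifting (Beukers 2006), crux ESectorBeukers] -/
def NaiveLiftAtOne : Prop :=
  ∀ (S : ℕ) (n : Fin S → ℕ) (f h : (i : Fin S) → MvPolynomial (Fin (n i)) ℚ) (c : Fin S → ℤ),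
    ∑ i, (c i : ℝ) * E (f i) (h i) 1 = 0 →
    ∃ L : Fin S → Polynomial ℝ, (∀ i, (L i).eval 1 = (c i : ℝ)) ∧
      ∀ ϖ ∈ Set.Icc (0:ℝ) 1, ∑ i, (L i).eval ϖ * E (f i) (h i) ϖ = 0

/-- Transfer: an integral over the cube `[0,1]¹ ⊂ ℝ^{Fin 1}` of a function of `z 0` is the interval
integral over `[0,1]`. [folklore] -/
theorem integral_cube_one (g : ℝ → ℝ) :
    ∫ z in cube 1, g (z 0) = ∫ t in (0:ℝ)..1, g t := by
  have hmp : MeasurePreserving (MeasurableEquiv.funUnique (Fin 1) ℝ) volume volume :=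
    MeasureTheory.volume_preserving_funUnique (Fin 1) ℝ
  have hset : cube 1 = (MeasurableEquiv.funUnique (Fin 1) ℝ) ⁻¹' Icc (0:ℝ) 1 := by
    ext z
    simp [cube, Pi.le_def, Fin.forall_fin_one, MeasurableEquiv.funUnique, Fin.default_eq_zero]
  rw [hset, intervalIntegral.integral_of_le zero_le_one, ← integral_Icc_eq_integral_Ioc]
  exact hmp.setIntegral_preimage_emb (MeasurableEquiv.funUnique (Fin 1) ℝ).measurableEmbedding
    g (Icc (0:ℝ) 1)

/-- The one-variable in-family witness `dilationWitness ϖ = ∫₀¹ e^{-ϖ t} (1 - 3t + t²) dt`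
(`P = [0,1]`, `f = z`, `h = 1 - 3z + z²`). -/
def dilationWitness (ϖ : ℝ) : ℝ := ∫ t in (0:ℝ)..1, Real.exp (-(ϖ * t)) * (1 - 3 * t + t ^ 2)

/-- The cube-form dilation function of the witness `(f, h) = (z, 1 - 3z + z²)` is `dilationWitness`. [folklore] -/
theorem E_witness_eq (ϖ : ℝ) :
    E (X 0 : MvPolynomial (Fin 1) ℚ) (1 - 3 * X 0 + X 0 ^ 2) ϖ = dilationWitness ϖ := by
  unfold E dilationWitness
  have h : ∀ z : Fin 1 → ℝ,
      Real.exp (-(ϖ * aeval z (X 0 : MvPolynomial (Fin 1) ℚ))) *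
        aeval z (1 - 3 * X 0 + X 0 ^ 2 : MvPolynomial (Fin 1) ℚ)
      = (fun t : ℝ => Real.exp (-(ϖ * t)) * (1 - 3 * t + t ^ 2)) (z 0) := by
    intro z
    simp [map_ofNat]
  simp_rw [h]
  exact integral_cube_one (fun t : ℝ => Real.exp (-(ϖ * t)) * (1 - 3 * t + t ^ 2))

/-- MODULE-reading certificate. For every real `ϖ`,
`∫₀¹ e^{-ϖ t} (ϖ t² - (2 + ϖ) t + 1) dt = 0` (the integrand is `d/dt[(t - t²) e^{-ϖ t}]`, which
vanishes at `t = 0, 1`). Read as `I₀ - (2+ϖ) I₁ + ϖ I₂ ≡ 0` among the members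
`I_k(ϖ) = ∫₀¹ t^k e^{-ϖ t} dt`; at `ϖ = 1` the coefficients are `(1, -3, 1)`. [folklore] -/
theorem moduleLift_witness (ϖ : ℝ) :
    ∫ t in (0:ℝ)..1, Real.exp (-(ϖ * t)) * (ϖ * t ^ 2 - (2 + ϖ) * t + 1) = 0 := by
  have hderiv : ∀ t ∈ Set.uIcc (0:ℝ) 1,
      HasDerivAt (fun t => Real.exp (-(ϖ * t)) * (t - t ^ 2))
        (Real.exp (-(ϖ * t)) * (ϖ * t ^ 2 - (2 + ϖ) * t + 1)) t := by
    intro t _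
    have h1 : HasDerivAt (fun t => Real.exp (-(ϖ * t))) (Real.exp (-(ϖ * t)) * (-(ϖ * 1))) t :=
      ((hasDerivAt_id t).const_mul ϖ).neg.exp
    have h2 : HasDerivAt (fun t : ℝ => t - t ^ 2) (1 - 2 * t) t :=
      ((hasDerivAt_id' t).sub (hasDerivAt_pow 2 t)).congr_deriv (by norm_num)
    exact (h1.mul h2).congr_deriv (by ring)
  have hint : IntervalIntegrable
      (fun t => Real.exp (-(ϖ * t)) * (ϖ * t ^ 2 - (2 + ϖ) * t + 1)) volume 0 1 := by
    apply Continuous.intervalIntegrable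
    fun_prop
  rw [intervalIntegral.integral_eq_sub_of_hasDerivAt hderiv hint]
  simp

/-- The numerical relation of the witness: `dilationWitness 1 = 0`. -/
theorem dilationWitness_one : dilationWitness 1 = 0 := by
  have h := moduleLift_witness 1
  unfold dilationWitness
  have heq : Set.EqOn (fun t : ℝ => Real.exp (-(1 * t)) * (1 - 3 * t + t ^ 2))
      (fun t : ℝ => Real.exp (-(1 * t)) * (1 * t ^ 2 - (2 + 1) * t + 1)) (Set.uIcc 0 1) := by
    intro t _
    show Real.exp (-(1 * t)) * (1 - 3 * t + t ^ 2) = Real.exp (-(1 * t)) * (1 * t ^ 2 - (2 + 1) * t + 1)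
    ring
  rw [intervalIntegral.integral_congr heq]
  exact h

/-- `dilationWitness 0 = ∫₀¹ (1 - 3t + t²) dt = -1/6 ≠ 0`. -/
theorem dilationWitness_zero : dilationWitness 0 = -1/6 := by
  unfold dilationWitness
  simp only [zero_mul, neg_zero, Real.exp_zero, one_mul]
  have hderiv : ∀ t ∈ Set.uIcc (0:ℝ) 1,
      HasDerivAt (fun t : ℝ => t - 3 / 2 * t ^ 2 + t ^ 3 / 3) (1 - 3 * t + t ^ 2) t := by
    intro t _
    refine (((hasDerivAt_id' t).sub ((hasDerivAt_pow 2 t).const_mul (3 / 2))).add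
      ((hasDerivAt_pow 3 t).div_const 3)).congr_deriv ?_
    norm_num
    ring
  have hint : IntervalIntegrable (fun t : ℝ => 1 - 3 * t + t ^ 2) volume 0 1 := by
    apply Continuous.intervalIntegrable
    fun_prop
  rw [intervalIntegral.integral_eq_sub_of_hasDerivAt hderiv hint]
  norm_num

/-- `dilationWitness` is continuous (parametric interval integral of a jointly continuous integrand). [folklore] -/
theorem continuous_dilationWitness : Continuous dilationWitness := by
  unfold dilationWitness
  exact intervalIntegral.continuous_parametric_intervalIntegral_of_continuous' (by fun_prop) 0 1

/-- **The naive reading of (d) is false.** Witness: `S = 1`, `n = 1`, `f = z`, `h = 1 - 3z + z²`,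
`c = 1`: `e(1) = 0` for `e := dilationWitness` (a genuine ℤ-relation among values at `ϖ = 1`), but no
polynomial `L` with `L(1) = 1` kills `e` on `[0,1]`, because `e` is continuous with `e(0) = -1/6 ≠ 0` while `L` has only
finitely many roots. [folklore; Beukers 2006 discusses the same phenomenon for `(z-1)e^z`] -/
theorem naiveLiftAtOne_false : ¬ NaiveLiftAtOne := by
  intro H
  obtain ⟨L, hL1, hrel⟩ := H 1 (fun _ => 1) (fun _ => (X 0 : MvPolynomial (Fin 1) ℚ))
    (fun _ => (1 - 3 * X 0 + X 0 ^ 2 : MvPolynomial (Fin 1) ℚ)) (fun _ => 1)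
    (by simp [E_witness_eq, dilationWitness_one])
  simp only [Fin.sum_univ_one, Int.cast_one, E_witness_eq] at hL1 hrel
  have hp1 : (L 0).eval 1 = 1 := hL1 0
  have hp0 : L 0 ≠ 0 := by
    intro h
    rw [h] at hp1
    simp at hp1
  -- `dilationWitness ≠ 0` on a neighbourhood of `0`
  have hev : ∀ᶠ ϖ in nhds (0:ℝ), dilationWitness ϖ ≠ 0 :=
    continuous_dilationWitness.continuousAt.eventually_ne (by rw [dilationWitness_zero]; norm_num)
  obtain ⟨δ, hδ, hball⟩ := Metric.eventually_nhds_iff.1 hev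
  -- infinitely many points in `(0, min δ 1)`, finitely many roots of `L 0`
  have hfin : {x : ℝ | (L 0).IsRoot x}.Finite := Polynomial.finite_setOf_isRoot hp0
  have hinf : (Set.Ioo (0:ℝ) (min δ 1)).Infinite := Set.Ioo_infinite (lt_min hδ one_pos)
  obtain ⟨ϖ, hϖ, hroot⟩ := (hinf.sdiff hfin).nonempty
  have hϖ1 : ϖ ∈ Set.Icc (0:ℝ) 1 := ⟨hϖ.1.le, (hϖ.2.trans_le (min_le_right _ _)).le⟩
  have hϖδ : dist ϖ 0 < δ := by
    rw [Real.dist_eq, sub_zero, abs_of_pos hϖ.1]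
    exact hϖ.2.trans_le (min_le_left _ _)
  have h3 : (L 0).eval ϖ ≠ 0 := fun h => hroot h
  exact mul_ne_zero h3 (hball hϖδ) (hrel ϖ hϖ1)

/-- Degenerate case `n = 0` of `E`: the cube is
the one-point space and `E f h ϖ = e^{-ϖ f(pt)} h(pt)`; a single such value vanishes at `1` only if
`h(pt) = 0`, when the function vanishes identically — so `n = 0` cannot refute the naive reading and
`n = 1` above is the minimal witness dimension. -/
example : cube 0 = Set.univ := by
  ext z; simp [cube]

end Summit.KontsevichZagierPeriods.KontsevichZagierPeriods.Theorems.ESectorBeukers.Negative
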